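import Summits.ResolutionOfSingularities.KangarooAtlas.MizutaniAttainedGeneralPoint
import Summits.ResolutionOfSingularities.KangarooAtlas.MizutaniLowerBound
import HarnessLib

/-!
# Mizutani's `m(e)` — attainment over an ARBITRARY field, II: the invariant forms through a finite tower

Cell topic `Summits/ResolutionOfSingularities/KangarooAtlas` (pub-rosobs); namespace
`Summit.ResolutionOfSingularities.KangarooAtlas.Mizutani.GenAtt`.  Part of the Lean transcription of the in-house
note MIZUTANI-PROOF-g59 (AI-written, AI-audited; *AI review is weaker than expert review*; NOT a resolution theorem).
General-field attainment (note Cor. 10.1: "`2p^e − 1` is attained as soon as `[k : k^p] ≥ p²`"), step II.  Over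
`k = 𝔽_p(u_0,u_1)` encloser-1 read the tensor `β_m(a) = Σ_i a_i ⊗ c_i^{p^m}` in the tower coordinates of `k` itself
(`k = k^{p^{e+m}}(u)`).  Over an arbitrary field `k` with a `p`-independent pair `u` this is replaced by the
FINITE-WITNESS argument of encloser-2's dictionary (note §3 (c) without a `p`-basis): `β_m(a) ∈ J^{q'}`,
`q' = p^{e+m}`, is realised (`MizutaniPowWitness`) inside `F ⊗ F` for the finite root tower `F = k^{q'}(b′)`,
`b′ ⊇ {u_0, u_1}` `p`-independent (`exists_pIndep_extend_adjoin`); there its coordinates are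
`Σ_i a_i (b′ + X)^{N_i}` with `N_i` = `p^m W_i` placed on the two indices of `u` — i.e. the RENAMING of the
two-variable polynomial `P_m(a) = Σ_i a_i (u + X)^{p^m W_i}` — and `J^{q'}` forces all monomials to have degree
`≥ q'`.  Main result:

* `degree_le_of_mem_invForms` — **`a ∈ (L_B)_{e+m}(attP) ⟹` every monomial of `Σ_i a_i (u + X)^{p^m W_i} ∈ k[X_0, X_1]`
  has degree `≥ p^{e+m}`** (the hypothesis of the key estimate, part III).

References: [Mizutani1973HironakaGroupSchemes] Remark 2.10 (in-house proof §3 (c), §10, Cor. 10.1);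
[Oda1983HironakaGroupSchemeII] §1 (p. 1166), §2 (p. 1168).
-/

open MvPolynomial TensorProduct Literature.AlgebraicGeometry.Resolution
  Literature.AlgebraicGeometry.Resolution.HironakaScheme

namespace Summit.ResolutionOfSingularities.KangarooAtlas.Mizutani.GenAtt

universe u

/-! ## Exponent vectors placed on a subset of the indices -/

section MapDomain

variable {M : Type*} [CommMonoid M] {s s' : ℕ}

/-- `∏_j g_j^{(ι_* V)_j} = ∏_l g_{ι l}^{V_l}` for an injective placement `ι`. [folklore] -/
theorem prod_pow_mapDomain (g : Fin s' → M) {ι : Fin s → Fin s'} (hι : Function.Injective ι) (V : Fin s →₀ ℕ) :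
    ∏ j, g j ^ (Finsupp.mapDomain ι V) j = ∏ l, g (ι l) ^ V l := by
  classical
  have h1 : ∏ j, g j ^ (Finsupp.mapDomain ι V) j = (Finsupp.mapDomain ι V).prod fun j n => g j ^ n :=
    (Finsupp.prod_fintype _ _ fun j => pow_zero _).symm
  have h2 : ∏ l, g (ι l) ^ V l = V.prod fun l n => g (ι l) ^ n :=
    (Finsupp.prod_fintype _ _ fun l => pow_zero _).symm
  rw [h1, h2, Finsupp.prod_mapDomain_index_inj hι]

variable {K : Type*} [Field K]

/-- `(a + X)^{ι_* V} = rename ι ((a ∘ ι + X)^V)`. [folklore] -/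
theorem pPlus_mapDomain (a : Fin s' → K) {ι : Fin s → Fin s'} (hι : Function.Injective ι) (V : Fin s →₀ ℕ) :
    pPlus a (Finsupp.mapDomain ι V) = rename ι (pPlus (a ∘ ι) V) := by
  unfold pPlus
  rw [prod_pow_mapDomain _ hι, map_prod]
  refine Finset.prod_congr rfl fun l _ => ?_
  rw [map_pow, map_add, rename_C, rename_X, Function.comp_apply]

omit [Field K] in
/-- A placed box vector stays in the box. [folklore] -/
theorem inBox_mapDomain {q : ℕ} (hq : 0 < q) {ι : Fin s → Fin s'} (hι : Function.Injective ι) {V : Fin s →₀ ℕ}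
    (hV : InBox q V) : InBox q (Finsupp.mapDomain ι V) := by
  classical
  intro j
  by_cases hj : j ∈ Set.range ι
  · obtain ⟨l, rfl⟩ := hj
    rw [Finsupp.mapDomain_apply hι]
    exact hV l
  · rw [Finsupp.mapDomain_notin_range _ _ hj]
    exact hq

/-- `map` of `(a + X)^V` along a ring map. [folklore] -/
theorem map_pPlus {K' : Type*} [Field K'] (f : K →+* K') (a : Fin s → K) (V : Fin s →₀ ℕ) :
    MvPolynomial.map f (pPlus a V) = pPlus (fun l => f (a l)) V := by
  unfold pPlus
  rw [map_prod]
  refine Finset.prod_congr rfl fun l _ => ?_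
  rw [map_pow, map_add, map_C, map_X]

end MapDomain

/-! ## The invariant forms of `attP` through a finite tower -/

section Transfer

variable {k : Type u} [Field k] {p e : ℕ} [hp : Fact p.Prime] [CharP k p] {u : Fin 2 → k}

/-- The two-variable polynomial `P_m(a) = Σ_i a_i (u + X)^{p^m W_i} ∈ k[X_0, X_1]` (encloser-1's `Omega_attBeta`
right-hand side, over an arbitrary field). [cite: Mizutani1973HironakaGroupSchemes, Remark 2.10 (in-house proof §1.2: 1 ⊗ a^W = (a ⊗ 1 − t)^W)] -/
noncomputable def attPoly (k : Type u) [Field k] (p e : ℕ) [Fact p.Prime] (u : Fin 2 → k) (m : ℕ)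
    (a : Fin (attN p e + 1) → k) : MvPolynomial (Fin 2) k :=
  ∑ i, C (a i) * pPlus u (p ^ m • attW p e i)

/-- **Coordinates through a finite tower.**  If `β_m(a) = Σ_i a_i ⊗ c_i^{p^m}` lies in `J^{p^{e+m}}` of
`k ⊗_{k^{p^{e+m}}} k`, then every monomial of `P_m(a) = Σ_i a_i (u + X)^{p^m W_i}` has degree `≥ p^{e+m}` — read in
the finite root tower `k^{p^{e+m}}(b′)`, `b′ ⊇ u` `p`-independent, where `β_m(a)` is realised and has coordinates
`rename (P_m(a))`. [cite: Mizutani1973HironakaGroupSchemes, Remark 2.10 (in-house proof §3 (c): finitely generated towers; §10)] -/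
theorem degree_le_of_attBeta_mem (hu : PIndep p 1 u) (he : 1 ≤ e) (m : ℕ) {a : Fin (attN p e + 1) → k}
    (hβ : attBeta k p e u m a ∈ KaehlerDifferential.ideal (frobPow k p (e + m)) k ^ p ^ (e + m)) :
    ∀ M ∈ (attPoly k p e u m a).support, p ^ (e + m) ≤ M.degree := by
  classical
  set K := frobPow k p (e + m) with hK
  -- (1) finite witnesses and a finite `p`-independent envelope `b' ⊇ u`
  obtain ⟨Y, hY⟩ := exists_finset_realised_pow (K := K) (p ^ (e + m)) hβ
  set Y' : Finset k := Y ∪ Finset.univ.image a with hY'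
  obtain ⟨s', b', hb', hub', hY'F⟩ := exists_pIndep_extend_adjoin (p := p) (e + m) Y' u hu
  have hb'e : PIndep p (e + m) b' := hb'.of_one _ (by omega)
  set F := towerField (e + m) b' with hF
  have hYF : (↑Y : Set k) ⊆ (F : Set k) :=
    Set.Subset.trans (Finset.coe_subset.mpr Finset.subset_union_left) hY'F
  have haF : ∀ i, a i ∈ F := fun i => hY'F (by
    rw [hY', Finset.coe_union]
    exact Or.inr (by simp))
  have huF : ∀ l, u l ∈ F := fun l => IntermediateField.subset_adjoin _ _ (hub' ⟨l, rfl⟩)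
  have hcF : ∀ i, attC k p e u i ^ p ^ m ∈ F := fun i => by
    unfold attC
    exact pow_mem (prod_mem fun l _ => pow_mem (huF l) _) _
  -- (2) the placement `ι` of the pair `u` among the generators `b'`
  have hι : ∀ l, ∃ j, b' j = u l := fun l => hub' ⟨l, rfl⟩
  choose ι hιu using hι
  have hιinj : Function.Injective ι := fun l l' h =>
    injective_of_pIndep hu (by rw [← hιu l, ← hιu l', h])
  -- (3) the explicit preimage of `β_m(a)` in `F ⊗ F`
  set ω' : F ⊗[K] F := ∑ i, (⟨a i, haF i⟩ : F) ⊗ₜ[K] (⟨attC k p e u i ^ p ^ m, hcF i⟩ : F) with hω'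
  have hmap : tensorIncl K F ω' = attBeta k p e u m a := by
    rw [hω', map_sum]
    unfold attBeta
    refine Finset.sum_congr rfl fun i _ => ?_
    rw [Algebra.TensorProduct.map_tmul]
    rfl
  obtain ⟨ω₂, hω₂J, hω₂eq⟩ := ((realised_iff K).mp hY) F hYF
  have hω₂eq' : ω₂ = ω' := tensorIncl_injective K F (hω₂eq.trans hmap.symm)
  have hJ' : ω' ∈ KaehlerDifferential.ideal K F ^ p ^ (e + m) := hω₂eq' ▸ hω₂J
  -- (4) the tower `F = K(b')` and the coordinates of `ω'`
  have h := isRootTower_adjoin hb'e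
  have hdeg := h.degree_le_of_mem_pow hJ'
  set N : Fin (attN p e + 1) → Fin s' →₀ ℕ := fun i => Finsupp.mapDomain ι (p ^ m • attW p e i) with hN
  have hNbox : ∀ i, InBox (p ^ (e + m)) (N i) := fun i =>
    inBox_mapDomain (pow_pos hp.out.pos _) hιinj (inBox_nsmul_attW he m i)
  have hcgen : ∀ i, (⟨attC k p e u i ^ p ^ m, hcF i⟩ : F) = ∏ j, towerGen (e + m) b' j ^ (N i) j := by
    intro i
    apply Subtype.ext
    show attC k p e u i ^ p ^ m = ((∏ j, towerGen (e + m) b' j ^ (N i) j : F) : k)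
    rw [attC_pow]
    simp only [hN]
    rw [prod_pow_mapDomain _ hιinj]
    push_cast
    refine Finset.prod_congr rfl fun l _ => ?_
    rw [coe_towerGen, hιu]
  set uF : Fin 2 → F := fun l => towerGen (e + m) b' (ι l) with huF'
  set P'' : MvPolynomial (Fin 2) F := ∑ i, C (⟨a i, haF i⟩ : F) * pPlus uF (p ^ m • attW p e i) with hP''
  have hOmega : h.Omega ω' = rename ι P'' := by
    rw [hω', map_sum, hP'', map_sum]
    refine Finset.sum_congr rfl fun i _ => ?_
    rw [h.Omega_tmul, hcgen, h.tau_prod_pow, truncQ_mk,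
      trunc_eq_self fun M hM => inBox_of_mem_support_pPlus (hNbox i) hM, map_mul, rename_C]
    congr 1
    simp only [hN]
    rw [pPlus_mapDomain _ hιinj]
    rfl
  -- (5) degrees of the two-variable polynomial over `F`, then over `k`
  have hdeg'' : ∀ M ∈ P''.support, p ^ (e + m) ≤ M.degree := by
    intro M hM
    have hM' : Finsupp.mapDomain ι M ∈ (h.Omega ω').support := by
      rw [hOmega, support_rename_of_injective hιinj]
      exact Finset.mem_image_of_mem _ hM
    have := hdeg _ hM'
    rwa [Finsupp.degree_mapDomain] at this
  have hPmap : attPoly k p e u m a = MvPolynomial.map (algebraMap F k) P'' := by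
    unfold attPoly
    rw [hP'', map_sum]
    refine Finset.sum_congr rfl fun i _ => ?_
    rw [map_mul, map_C, map_pPlus]
    congr 2
    funext l
    rw [huF']
    show u l = ((towerGen (e + m) b' (ι l) : F) : k)
    rw [coe_towerGen, hιu]
  intro M hM
  rw [hPmap, support_map_of_injective _ (algebraMap F k).injective] at hM
  exact hdeg'' M hM

/-- **`a ∈ (L_B)_{e+m}(attP) ⟹` all monomials of `Σ_i a_i (u + X)^{p^m W_i}` have degree `≥ p^{e+m}`** (over any
field `k` of characteristic `p` with a `p`-independent pair `u`). [cite: Mizutani1973HironakaGroupSchemes, Remark 2.10 (dim H_e = 2p^e − 1; in-house proof §10, Cor. 10.1)] -/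
theorem degree_le_of_mem_invForms (hu : PIndep p 1 u) (he : 1 ≤ e) (m : ℕ) {a : Fin (attN p e + 1) → k}
    (ha : a ∈ invForms k p (attP k p e u) (e + m)) :
    ∀ M ∈ (attPoly k p e u m a).support, p ^ (e + m) ≤ M.degree :=
  degree_le_of_attBeta_mem hu he m ((mem_invForms_attP_iff m a).mp ha)

end Transfer

end Summit.ResolutionOfSingularities.KangarooAtlas.Mizutani.GenAtt
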